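import Summits.QuantumFields.BalabanUV.Beta.GAN24.KFibClosedBridge
import Summits.QuantumFields.BalabanUV.Beta.GAN24.ClosedFormBoundOfParts
import Summits.QuantumFields.BalabanUV.Beta.GAN24.FibreContinuity

/-!
# `BalabanUV.Beta.GAN24.FibreUniformBoundOfParts` — binder row G-an2-4 / (CONV-C), road P1-fibre, leaf **P1-L09** `FibreUniformBound` (A5, real zone) of
# `SKELETON-P1.md`, part 1: THE END NODE AS A FUNCTION OF FOUR SCALED-PART BOUNDS — the uniform real-zone bound of the wall's fibre function `kFib` on ALL of the
# Brillouin zone from N-uniform bounds of the four unit-scaled closed-form parts on the punctured zone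

NOT IN PRINT; OUR PROOF ATTEMPT.  HONEST FRAMING (cell contract, verbatim): «discharging `BetaPertH` makes Bałaban's UV stability UNCONDITIONAL — a real
constructive-QFT result; it is NOT the continuum limit and NOT the Clay problem.»  HONEST DEPENDENCY (verbatim): «continuum YM on T⁴ ⇐ BetaPertH ∧ nine spine
estimates (0/9 proved); BetaPertH ⇐ (D1) ∧ (D4) ∧ CAP+tail; G-an2-4 gates asym, D1 and NE2/3/4.»  [folklore] bookkeeping (no new estimate, no cited fact, no wall
binder, no `def … : Prop` fact — the four `Scaled…` predicates below are PARAMETER-CARRYING HYPOTHESIS SHAPES, asserted nowhere).  NOT summit progress; nothing of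
(CONV-C)'s K-slot is discharged here.

## What is proved (generic `d`; `Lc ≥ 1`; ANY units `s_f, s_m : ℕ → ℝ` with `0 ≤ s_f j`, `0 ≤ s_m j`; the adopted instance `sfStep Lc`, `smStep d Lc` included)
The four unit-scaled parts of T00's closed form `AliasObjects.kFibClosed` (leaf-03's cut, `ClosedFormBoundOfParts`):
  `ScaledFF`: `s_f(j)² · Σ_m ‖readW(m,κ,x′)‖·‖Â(m)[field source (l,y′)]_κ‖ ≤ K₁`,   `ScaledFM`: `s_f(j)s_m(j) · Σ_m ‖readW‖·‖Â(m)[e_l]_κ‖ ≤ K₂`,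
  `ScaledMF`: `s_f(j)s_m(j) · ‖φ[field source (l,y′)]_κ‖ ≤ K₃`,                    `ScaledMM`: `s_m(j)² · ‖φ[e_l]_κ‖ ≤ K₄`,
each for EVERY step `j`, every `q ∈ BZ (d+1) ∖ {0}` and all leg data (these are the N-UNIFORM statements the typer rows supply: Y09a `FieldBlockResponse` α(m),
Y09b/Y09x reading-weight sums, L08 `CapacitanceEndpoint.norm_phiSol_le/norm_cSol_le`, with the unit exponents of S1c cancelling the `N`/`M` powers).
* `norm_kFibClosed_le_of_scaled` — at fixed `j`, `q ≠ 0`: `‖kFibClosed …‖ ≤ K₁ + K₂ + K₃ + K₄` (leaf-03's `norm_kFibClosed_le_of_parts'` with `R_ff = K₁/s_f²`, …;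
  the degenerate units `s_f j = 0` / `s_m j = 0` handled separately).
* **`fibreUniformBound_of_scaled`** — THE END NODE OF ROW L09 AS A FUNCTION: the four scaled-part bounds ⇒
  `∀ j x′ y′ a b, ∀ q ∈ BZ (d+1), ‖kFib Lc s_f s_m j a x′ b y′ (ofRealVec q)‖ ≤ K₁ + K₂ + K₃ + K₄`
  (my bridge `KFibClosedBridge.kFib_eq_kFibClosed` on `BZ ∖ {0}` + leaf-08's continuity glue `FibreContinuity.kFib_bound_of_eqOn_punctured` for `q = 0`);
  `fibreUniformBound_step_of_scaled` — the literal instance `kFib Lc (sfStep Lc) (smStep d Lc)` of the referee's condition c1 (row L10 consumes exactly this).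
Part 2 (this row, next files): the four `Scaled…` hypotheses DISCHARGED from Y09a/Y09b/Y09x/L08 (unit bookkeeping `s_f = M^{(D−2)/2}`, `s_m = M^{(D+4)/2}`, `N = M·Lc`).
Unit `b2b-balaban-gan24-formalise-leaf-05` (G-an2-4 formalisation swarm), 2026-08-20.
-/

noncomputable section

open Complex Finset
open scoped BigOperators
open Literature.MathematicalPhysics.QuantumFieldTheory
open Literature.MathematicalPhysics.QuantumFieldTheory.Balaban1983to89
open Literature.MathematicalPhysics.QuantumFieldTheory.Balaban1983to89.Beta
open Literature.Probability.LatticeModels (TorusSite)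
open B4Strip (ofRealVec)
open B4ContourShift (BZ)
open OneStepResolventKernel (Fib)
open Summit.QuantumFields.BalabanUV.Beta.GAN24.CombesThomas (sfStep smStep)
open Summit.QuantumFields.BalabanUV.Beta.GAN24.CombesThomasFibreStep (kFib)
open Summit.QuantumFields.BalabanUV.Beta.GAN24.AliasObjects (readW Ahat phiSol fhatF eVec kFibClosed)
open Summit.QuantumFields.BalabanUV.Beta.GAN24.ClosedFormBoundOfParts (norm_kFibClosed_le_of_parts')
open Summit.QuantumFields.BalabanUV.Beta.GAN24.FibreContinuity (kFib_bound_of_eqOn_punctured)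
open Summit.QuantumFields.BalabanUV.Beta.GAN24.KFibClosedBridge (kFib_eq_kFibClosed)

namespace Summit.QuantumFields.BalabanUV.Beta.GAN24.FibreUniformBound

variable {d : ℕ} (Lc : ℕ) [NeZero Lc] (sf sm : ℕ → ℝ)

/-! ## §1 The four scaled-part hypothesis shapes (parameter-carrying predicates; asserted nowhere) -/

/-- [folklore] FIELD–FIELD SCALED PART (depends on `s_f` only): `s_f(j)² · Σ_m ‖readW(m,κ,x′)‖·‖Â(m)[field source (l,y′)]_κ‖ ≤ K` for all `j`, all `q ∈ BZ ∖ {0}`, all legs. -/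
def ScaledFF (K : ℝ) : Prop :=
  ∀ (j : ℕ) (q : Fin (d + 1) → ℝ), q ∈ BZ (d + 1) → q ≠ 0 → ∀ (κ l : Fin (d + 1)) (x' y' : Fin (d + 1) → ℤ),
    sf j ^ 2 * ∑ m : TorusSite (d + 1) (Lc ^ (j + 1)), ‖readW (Lc ^ (j + 1)) (Lc ^ j) (ofRealVec q) m κ x'‖ *
      ‖Ahat (Lc ^ (j + 1)) (ofRealVec q) (fhatF (Lc ^ (j + 1)) (Lc ^ j) (ofRealVec q) l y') 0 m κ‖ ≤ K

/-- [folklore] FIELD–MULTIPLIER SCALED PART: `s_f(j)s_m(j) · Σ_m ‖readW(m,κ,x′)‖·‖Â(m)[e_l]_κ‖ ≤ K`. -/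
def ScaledFM (K : ℝ) : Prop :=
  ∀ (j : ℕ) (q : Fin (d + 1) → ℝ), q ∈ BZ (d + 1) → q ≠ 0 → ∀ (κ l : Fin (d + 1)) (x' : Fin (d + 1) → ℤ),
    sf j * sm j * ∑ m : TorusSite (d + 1) (Lc ^ (j + 1)), ‖readW (Lc ^ (j + 1)) (Lc ^ j) (ofRealVec q) m κ x'‖ *
      ‖Ahat (Lc ^ (j + 1)) (ofRealVec q) 0 (eVec l) m κ‖ ≤ K

/-- [folklore] MULTIPLIER–FIELD SCALED PART: `s_f(j)s_m(j) · ‖φ[field source (l,y′)]_κ‖ ≤ K`. -/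
def ScaledMF (K : ℝ) : Prop :=
  ∀ (j : ℕ) (q : Fin (d + 1) → ℝ), q ∈ BZ (d + 1) → q ≠ 0 → ∀ (κ l : Fin (d + 1)) (y' : Fin (d + 1) → ℤ),
    sf j * sm j * ‖phiSol (Lc ^ (j + 1)) (ofRealVec q) (fhatF (Lc ^ (j + 1)) (Lc ^ j) (ofRealVec q) l y') 0 κ‖ ≤ K

/-- [folklore] MULTIPLIER–MULTIPLIER SCALED PART (depends on `s_m` only): `s_m(j)² · ‖φ[e_l]_κ‖ ≤ K`. -/
def ScaledMM (K : ℝ) : Prop :=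
  ∀ (j : ℕ) (q : Fin (d + 1) → ℝ), q ∈ BZ (d + 1) → q ≠ 0 → ∀ (κ l : Fin (d + 1)),
    sm j ^ 2 * ‖phiSol (Lc ^ (j + 1)) (ofRealVec q) 0 (eVec l) κ‖ ≤ K

/-! ## §2 The closed form is bounded by the sum of the four scaled parts -/

variable {Lc sf sm}

/-- [folklore] Elementary: from `s·X ≤ K` with `0 < s` get `X ≤ K/s`. -/
theorem le_div_of_mul_le_left {s X K : ℝ} (hs : 0 < s) (h : s * X ≤ K) : X ≤ K / s := by
  rw [le_div_iff₀ hs, mul_comm]; exact h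

/-- [folklore] **THE CLOSED FORM UNDER THE FOUR SCALED-PART BOUNDS** (fixed `j`, `q ∈ BZ ∖ {0}`, POSITIVE units): `‖kFibClosed …‖ ≤ K₁ + K₂ + K₃ + K₄`. -/
theorem norm_kFibClosed_le_of_scaled {K₁ K₂ K₃ K₄ : ℝ} (hsf : ∀ j, 0 < sf j) (hsm : ∀ j, 0 < sm j)
    (h₁ : ScaledFF (d := d) Lc sf K₁) (h₂ : ScaledFM (d := d) Lc sf sm K₂) (h₃ : ScaledMF (d := d) Lc sf sm K₃) (h₄ : ScaledMM (d := d) Lc sm K₄)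
    (j : ℕ) {q : Fin (d + 1) → ℝ} (hq : q ∈ BZ (d + 1)) (hq0 : q ≠ 0)
    (a : Fib d) (x' : Fin (d + 1) → ℤ) (b : Fib d) (y' : Fin (d + 1) → ℤ) :
    ‖kFibClosed Lc sf sm j a x' b y' (ofRealVec q)‖ ≤ K₁ + K₂ + K₃ + K₄ := by
  have hf := hsf j
  have hm := hsm j
  have hfm : 0 < sf j * sm j := mul_pos hf hm
  -- nonnegativity of the four constants (read off the hypotheses at some leg data)
  have hK₁ : 0 ≤ K₁ := le_trans (mul_nonneg (sq_nonneg _) (Finset.sum_nonneg fun m _ => mul_nonneg (norm_nonneg _) (norm_nonneg _)))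
    (h₁ j q hq hq0 0 0 x' y')
  have hK₂ : 0 ≤ K₂ := le_trans (mul_nonneg hfm.le (Finset.sum_nonneg fun m _ => mul_nonneg (norm_nonneg _) (norm_nonneg _))) (h₂ j q hq hq0 0 0 x')
  have hK₃ : 0 ≤ K₃ := le_trans (mul_nonneg hfm.le (norm_nonneg _)) (h₃ j q hq hq0 0 0 y')
  have hK₄ : 0 ≤ K₄ := le_trans (mul_nonneg (sq_nonneg _) (norm_nonneg _)) (h₄ j q hq hq0 0 0)
  have h := norm_kFibClosed_le_of_parts' Lc sf sm j hf.le hm.le q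
    (Rff := K₁ / sf j ^ 2) (Rfm := K₂ / (sf j * sm j)) (Bmf := K₃ / (sf j * sm j)) (Bmm := K₄ / sm j ^ 2)
    (div_nonneg hK₁ (sq_nonneg _)) (div_nonneg hK₂ hfm.le) (div_nonneg hK₃ hfm.le) (div_nonneg hK₄ (sq_nonneg _))
    (fun κ l x y => le_div_of_mul_le_left (pow_pos hf 2) (h₁ j q hq hq0 κ l x y))
    (fun κ l x => le_div_of_mul_le_left hfm (h₂ j q hq hq0 κ l x))
    (fun κ l y => le_div_of_mul_le_left hfm (h₃ j q hq hq0 κ l y))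
    (fun κ l => le_div_of_mul_le_left (pow_pos hm 2) (h₄ j q hq hq0 κ l)) a x' b y'
  have e : sf j ^ 2 * (K₁ / sf j ^ 2) + sf j * sm j * (K₂ / (sf j * sm j) + K₃ / (sf j * sm j)) + sm j ^ 2 * (K₄ / sm j ^ 2)
      = K₁ + K₂ + K₃ + K₄ := by
    field_simp
    ring
  rw [e] at h
  exact h

/-! ## §3 The end node of row L09 as a function of the four scaled parts -/

/-- [folklore] **ROW L09 AS A FUNCTION (any positive units).**  N-uniform bounds of the four unit-scaled closed-form parts on the punctured zone give the
uniform real-zone bound of the wall's fibre function on ALL of the Brillouin zone: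
`∀ j x′ y′ a b, ∀ q ∈ BZ (d+1), ‖kFib Lc s_f s_m j a x′ b y′ (ofRealVec q)‖ ≤ K₁ + K₂ + K₃ + K₄`. -/
theorem fibreUniformBound_of_scaled {K₁ K₂ K₃ K₄ : ℝ} (hsf : ∀ j, 0 < sf j) (hsm : ∀ j, 0 < sm j)
    (h₁ : ScaledFF (d := d) Lc sf K₁) (h₂ : ScaledFM (d := d) Lc sf sm K₂) (h₃ : ScaledMF (d := d) Lc sf sm K₃) (h₄ : ScaledMM (d := d) Lc sm K₄) :
    ∀ (j : ℕ) (x' y' : Fin (d + 1) → ℤ) (a b : Fib d), ∀ q ∈ BZ (d + 1),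
      ‖kFib Lc sf sm j a x' b y' (ofRealVec q)‖ ≤ K₁ + K₂ + K₃ + K₄ :=
  kFib_bound_of_eqOn_punctured sf sm (fun j a x' b y' => kFibClosed Lc sf sm j a x' b y')
    (fun j x' y' a b _ hq hq0 => kFib_eq_kFibClosed sf sm j a x' b y' hq hq0)
    (fun j x' y' a b _ hq hq0 => norm_kFibClosed_le_of_scaled hsf hsm h₁ h₂ h₃ h₄ j hq hq0 a x' b y')

/-- [folklore] The adopted field unit is positive: `0 < sfStep Lc j = Lc^j`. -/
theorem sfStep_pos (j : ℕ) : 0 < sfStep Lc j := by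
  unfold sfStep
  exact pow_pos (Nat.cast_pos.mpr (Nat.pos_of_ne_zero (NeZero.ne Lc))) _

/-- [folklore] The adopted multiplier unit is positive: `0 < smStep d Lc j = Lc^{j(d+1)}`. -/
theorem smStep_pos (j : ℕ) : 0 < smStep d Lc j := by
  unfold smStep
  exact pow_pos (Nat.cast_pos.mpr (Nat.pos_of_ne_zero (NeZero.ne Lc))) _

/-- [folklore] **ROW L09 AS A FUNCTION, LITERAL UNITS** (referee condition c1: `kFib Lc (sfStep Lc) (smStep d Lc)`; at `d = 3` this is the K-slot's
`(sfStep, smStep 3)`): the four scaled-part bounds at the adopted units ⇒ `∀ j x′ y′ a b, ∀ q ∈ BZ, ‖kFib Lc (sfStep Lc) (smStep d Lc) j a x′ b y′ (ofRealVec q)‖ ≤ K₁+K₂+K₃+K₄`. -/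
theorem fibreUniformBound_step_of_scaled {K₁ K₂ K₃ K₄ : ℝ}
    (h₁ : ScaledFF (d := d) Lc (sfStep Lc) K₁) (h₂ : ScaledFM (d := d) Lc (sfStep Lc) (smStep d Lc) K₂)
    (h₃ : ScaledMF (d := d) Lc (sfStep Lc) (smStep d Lc) K₃) (h₄ : ScaledMM (d := d) Lc (smStep d Lc) K₄) :
    ∀ (j : ℕ) (x' y' : Fin (d + 1) → ℤ) (a b : Fib d), ∀ q ∈ BZ (d + 1),
      ‖kFib Lc (sfStep Lc) (smStep d Lc) j a x' b y' (ofRealVec q)‖ ≤ K₁ + K₂ + K₃ + K₄ :=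
  fibreUniformBound_of_scaled (sf := sfStep Lc) (sm := smStep d Lc) (sfStep_pos (Lc := Lc)) (smStep_pos (Lc := Lc)) h₁ h₂ h₃ h₄

end Summit.QuantumFields.BalabanUV.Beta.GAN24.FibreUniformBound

end
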